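import Mathlib
import HarnessLib

/-!
# Token sliding on a connected graph

Trunk T-QLATTICE, family `hubbard`. The connectivity input of Lieb's uniqueness argument
(PRL 62 (1989) 1201, proof of Theorem 1(b): "since `Λ` is connected by `T`, it is easy to see that
the `α`'s are connected by `K`"; Miyao, arXiv:1402.5202, Proposition 5.2): on a finite connected
simple graph, the configurations of `n` indistinguishable tokens (the `n`-subsets of the vertex
set) are connected under single slides of one token along an edge to an empty vertex. Stated as
`exists_slide_out`: every set of `n`-subsets that is neither empty nor all of them is left by one
legal slide. Proof (folklore): pick `a ∈ S`, `b ∉ S` with `#(a ∩ b)` maximal, then exclusive tokens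
`x ∈ a ∖ b`, `y ∈ b ∖ a` at minimal graph distance, and look at the first step of a shortest
`x–y` path (four cases).
-/

noncomputable section

namespace Literature.MathematicalPhysics.QuantumLattice

open Matrix Finset
open scoped ComplexOrder

section TokenSliding

variable {Λ : Type*} [DecidableEq Λ] [Fintype Λ] (G : SimpleGraph Λ)

omit [Fintype Λ] in
/-- A slide of one token along an edge keeps the number of tokens. [folklore] -/
theorem card_slide {a : Finset Λ} {x y : Λ} (hx : x ∈ a) (hy : y ∉ a) :
    (insert y (a.erase x)).card = a.card := by
  rw [card_insert_of_notMem (fun h => hy (mem_of_mem_erase h)), card_erase_of_mem hx]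
  exact Nat.sub_add_cancel (card_pos.2 ⟨x, hx⟩)

omit [Fintype Λ] in
/-- Two distinct sets of the same size each contain an element missing from the other. [folklore] -/
theorem exists_mem_not_mem_of_card_eq {a b : Finset Λ} (hab : a ≠ b) (hcard : a.card = b.card) :
    ∃ x ∈ a, x ∉ b := by
  by_contra h
  push Not at h
  exact hab (Finset.eq_of_subset_of_card_le h hcard.ge)

/-- **Token sliding is connected** (Lieb: "since `Λ` is connected by `T`, it is easy to see that
the `α`'s are connected by `K`"; Miyao, arXiv:1402.5202, Proposition 5.2: `∧ⁿG` is connected when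
`G` is): on a connected finite graph, every set `S` of `n`-subsets which is neither empty nor
everything (among `n`-subsets) is left by a single slide of one token along an edge.
Proof: choose `a ∈ S`, `b ∉ S` with `#(a ∩ b)` maximal and then tokens `x ∈ a ∖ b`, `y ∈ b ∖ a` at
minimal graph distance; the first step of a shortest `x–y` path produces either a legal slide
increasing `#(a ∩ b)` or a closer pair. [cite: LiebPRL1989, proof of Theorem 1(b)] -/
theorem exists_slide_out (hG : G.Connected) (n : ℕ) (S : Set (Finset Λ))
    (ha : ∃ a ∈ S, a.card = n) (hb : ∃ b ∉ S, b.card = n) :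
    ∃ a ∈ S, a.card = n ∧ ∃ x ∈ a, ∃ y ∉ a, G.Adj x y ∧ insert y (a.erase x) ∉ S := by
  classical
  by_contra hcl
  push Not at hcl
  -- `S` and its complement are closed under slides
  have hcl' : ∀ b ∉ S, b.card = n → ∀ x ∈ b, ∀ y ∉ b, G.Adj x y → insert y (b.erase x) ∉ S := by
    intro b hbS hbn x hx y hy hxy hb'S
    have hxy' : x ≠ y := G.ne_of_adj hxy
    have hyb' : y ∈ insert y (b.erase x) := mem_insert_self _ _
    have hxb' : x ∉ insert y (b.erase x) := by simp [hxy']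
    have h := hcl _ hb'S (by rw [card_slide hx hy, hbn]) y hyb' x hxb' hxy.symm
    rw [erase_insert (fun h => hy (mem_of_mem_erase h)), insert_erase hx] at h
    exact hbS h
  -- maximise the overlap
  set P : Finset (Finset Λ × Finset Λ) :=
    univ.filter fun p => p.1 ∈ S ∧ p.2 ∉ S ∧ p.1.card = n ∧ p.2.card = n with hP
  obtain ⟨a₁, ha₁, ha₁n⟩ := ha
  obtain ⟨b₁, hb₁, hb₁n⟩ := hb
  have hPne : P.Nonempty := ⟨(a₁, b₁), by simp [hP, ha₁, hb₁, ha₁n, hb₁n]⟩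
  obtain ⟨p₀, hp₀, hmax⟩ := P.exists_max_image (fun p => (p.1 ∩ p.2).card) hPne
  set m := (p₀.1 ∩ p₀.2).card with hm
  -- then minimise the distance between exclusive tokens
  set R : Finset ((Finset Λ × Finset Λ) × (Λ × Λ)) :=
    univ.filter fun q => q.1 ∈ P ∧ (q.1.1 ∩ q.1.2).card = m ∧
      q.2.1 ∈ q.1.1 ∧ q.2.1 ∉ q.1.2 ∧ q.2.2 ∈ q.1.2 ∧ q.2.2 ∉ q.1.1 with hR
  have hmemP : ∀ p : Finset Λ × Finset Λ, p ∈ P ↔ p.1 ∈ S ∧ p.2 ∉ S ∧ p.1.card = n ∧ p.2.card = n := by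
    intro p; simp [hP]
  have hmemR : ∀ q : (Finset Λ × Finset Λ) × (Λ × Λ), q ∈ R ↔ q.1 ∈ P ∧ (q.1.1 ∩ q.1.2).card = m ∧
      q.2.1 ∈ q.1.1 ∧ q.2.1 ∉ q.1.2 ∧ q.2.2 ∈ q.1.2 ∧ q.2.2 ∉ q.1.1 := by
    intro q; simp only [hR, mem_filter, mem_univ, true_and]
  have hRne : R.Nonempty := by
    obtain ⟨h1, h2, h3, h4⟩ := (hmemP p₀).1 hp₀
    have hne : p₀.1 ≠ p₀.2 := fun h => h2 (h ▸ h1)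
    obtain ⟨x, hx, hxb⟩ := exists_mem_not_mem_of_card_eq hne (h3.trans h4.symm)
    obtain ⟨y, hy, hya⟩ := exists_mem_not_mem_of_card_eq hne.symm (h4.trans h3.symm)
    exact ⟨(p₀, (x, y)), (hmemR (p₀, (x, y))).2 ⟨hp₀, rfl, hx, hxb, hy, hya⟩⟩
  obtain ⟨q, hq, hmin⟩ := R.exists_min_image (fun q => G.dist q.2.1 q.2.2) hRne
  obtain ⟨⟨a, b⟩, ⟨x, y⟩⟩ := q
  obtain ⟨hqP, hqm, hx, hxb, hy, hya⟩ := (hmemR _).1 hq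
  obtain ⟨haS, hbS, han, hbn⟩ := (hmemP _).1 hqP
  simp only at hqP hqm hx hxb hy hya haS hbS han hbn hmin
  have hxy : x ≠ y := fun h => hxb (h ▸ hy)
  -- first step of a shortest path from `x` to `y`
  obtain ⟨w, hw⟩ := hG.exists_walk_length_eq_dist x y
  cases w with
  | nil => exact hxy rfl
  | @cons _ v _ hxv w' =>
    rw [SimpleGraph.Walk.length_cons] at hw
    have hdv : G.dist v y < G.dist x y := by
      have := SimpleGraph.dist_le w'
      omega
    have hvx : v ≠ x := hxv.ne.symm
    by_cases hvy : v = y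
    · -- `x ∼ y`: slide `x → y` inside `a` increases the overlap
      have hxy' : G.Adj x y := hvy ▸ hxv
      have ha' : insert y (a.erase x) ∈ S := hcl a haS han x hx y hya hxy'
      have hle := hmax (insert y (a.erase x), b) ((hmemP _).2 ⟨ha', hbS, by rw [card_slide hx hya, han], hbn⟩)
      have heq : insert y (a.erase x) ∩ b = insert y (a ∩ b) := by
        ext z
        simp only [mem_inter, mem_insert, mem_erase]
        constructor
        · rintro ⟨rfl | ⟨hzx, hza⟩, hzb⟩
          · exact Or.inl rfl
          · exact Or.inr ⟨hza, hzb⟩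
        · rintro (rfl | ⟨hza, hzb⟩)
          · exact ⟨Or.inl rfl, hy⟩
          · exact ⟨Or.inr ⟨fun h => hxb (h ▸ hzb), hza⟩, hzb⟩
      rw [heq, card_insert_of_notMem (fun h => hya (mem_inter.1 h).1)] at hle
      change (a ∩ b).card + 1 ≤ m at hle
      omega
    · by_cases hva : v ∈ a <;> by_cases hvb : v ∈ b
      · -- `v ∈ a ∩ b`: slide `v → x` inside `b`
        have hb' : insert x (b.erase v) ∉ S := hcl' b hbS hbn v hvb x hxb hxv.symm
        have hcard' : (a ∩ insert x (b.erase v)).card = m := by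
          have heq : a ∩ insert x (b.erase v) = insert x ((a ∩ b).erase v) := by
            ext z
            simp only [mem_inter, mem_insert, mem_erase]
            constructor
            · rintro ⟨hza, rfl | ⟨hzv, hzb⟩⟩
              · exact Or.inl rfl
              · exact Or.inr ⟨hzv, hza, hzb⟩
            · rintro (rfl | ⟨hzv, hza, hzb⟩)
              · exact ⟨hx, Or.inl rfl⟩
              · exact ⟨hza, Or.inr ⟨hzv, hzb⟩⟩
          rw [heq, card_insert_of_notMem (fun h => hxb (mem_inter.1 (mem_of_mem_erase h)).2),
            card_erase_of_mem (mem_inter.2 ⟨hva, hvb⟩), ← hqm]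
          exact Nat.sub_add_cancel (card_pos.2 ⟨v, mem_inter.2 ⟨hva, hvb⟩⟩)
        have hq' : ((a, insert x (b.erase v)), (v, y)) ∈ R := by
          refine (hmemR ((a, insert x (b.erase v)), (v, y))).2 ⟨(hmemP _).2 ⟨haS, hb', han, by rw [card_slide hvb hxb, hbn]⟩, hcard', hva, ?_, ?_, hya⟩
          · simp [hvx]
          · simp [Ne.symm hvy, hy]
        have := hmin _ hq'
        change G.dist x y ≤ G.dist v y at this
        omega
      · -- `v ∈ a ∖ b`: closer exclusive pair `(v, y)`
        have hq' : ((a, b), (v, y)) ∈ R := (hmemR ((a, b), (v, y))).2 ⟨hqP, hqm, hva, hvb, hy, hya⟩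
        have := hmin _ hq'
        change G.dist x y ≤ G.dist v y at this
        omega
      · -- `v ∈ b ∖ a`: the pair `(x, v)` is at distance `1 < dist x y`
        have hq' : ((a, b), (x, v)) ∈ R := (hmemR ((a, b), (x, v))).2 ⟨hqP, hqm, hx, hxb, hvb, hva⟩
        have h1 := hmin _ hq'
        change G.dist x y ≤ G.dist x v at h1
        rw [SimpleGraph.dist_eq_one_iff_adj.2 hxv] at h1
        have h2 := hG.pos_dist_of_ne hvy
        omega
      · -- `v ∉ a ∪ b`: slide `x → v` inside `a`
        have ha' : insert v (a.erase x) ∈ S := hcl a haS han x hx v hva hxv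
        have hcard' : (insert v (a.erase x) ∩ b).card = m := by
          have heq : insert v (a.erase x) ∩ b = a ∩ b := by
            ext z
            simp only [mem_inter, mem_insert, mem_erase]
            constructor
            · rintro ⟨rfl | ⟨-, hza⟩, hzb⟩
              · exact absurd hzb hvb
              · exact ⟨hza, hzb⟩
            · rintro ⟨hza, hzb⟩
              exact ⟨Or.inr ⟨fun h => hxb (h ▸ hzb), hza⟩, hzb⟩
          rw [heq, hqm]
        have hq' : ((insert v (a.erase x), b), (v, y)) ∈ R := by
          refine (hmemR ((insert v (a.erase x), b), (v, y))).2 ⟨(hmemP _).2 ⟨ha', hbS, by rw [card_slide hx hva, han], hbn⟩, hcard',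
            mem_insert_self _ _, hvb, hy, ?_⟩
          simp [Ne.symm hvy, hya]
        have := hmin _ hq'
        change G.dist x y ≤ G.dist v y at this
        omega

end TokenSliding

end Literature.MathematicalPhysics.QuantumLattice
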